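import Summits.Ventures.PercRepro.MSTightConjTAlpha

/-!
# Conjecture (T) in case (β): the tight half with a partnerless top

Dossier proofs/MINE1-theoremS.md, Addendum 45 (supplement 1). Case (β) of the excess split
(`X ∩ Y = K ∖∖ K`), trace `P = proj r F` tight and twin-free. On the census the non-monotone
case-(β) configurations not covered by MSTightConjTBeta (a tight half whose addable part `R*` is
a partner member) all have the tight half's addable part as its ONLY partnerless member:
`F₁` tight with `P₁ = {R*(F₁)}`, or `F₀` tight with `P₀ = {R*(F₀)}`. This file covers them under
a hypothesis on the partner family:
* `F₁` tight, every partnerless `r`-member inside `R₁ = Rstar F₁`, and some partner member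
  `k ⊇ R₁`: then `Y ⊆ X` (`diffsY_subset_diffsX_of_tight_partr_sub`) — for `s ∈ F₀` the
  difference `k ∖ s ∈ K ∖∖ K ⊆ flip R₁ F₁` is `b ∆ R₁` for a member `b ∈ F₁` disjoint from
  `t ∖ s` whenever `t ⊆ R₁`, and the realisation lemma `sdiff_mem_diffsX_of_disjoint_mem_partr`
  applies (when `R₁ ∈ K` take `k = R₁`: this generalises MSTightConjTBeta in the case
  `P₁ ⊆ 2^{R₁}`);
* the mirror: `F₀` tight, every partnerless `r`-free member above `R₀ = Rstar F₀`, and some partner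
  member `k ⊆ R₀`: then `Y ⊆ X` (`diffsY_subset_diffsX_of_tight_part0_sup`) — `t ∖ k ∈ K ∖∖ K ⊆
  flip R₀ F₀` is `a ∆ R₀` for `a ∈ F₀` containing `t ∖ s` whenever `R₀ ⊆ s`.
What remains open in case (β) after this file: the residual configurations in which the partner
family has no member comparable with the tight half's top in the required direction (on the
census: `F₁ = U₁` an up-set inside `R₁` with `K = U₁ ∖ {R₁}`, and the mirror).
-/

namespace PercRepro.MSTight

open Finset
open scoped FinsetFamily symmDiff

variable {α : Type*} [DecidableEq α] [Fintype α] {r : α} {F : Finset (Finset α)}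

variable (hP : Tight (proj r F)) (htf : ∀ a b, Twin (proj r F) a b → a = b)
  (hβ : diffsX r F ∩ diffsY r F = partner r F \\ partner r F)
include hP htf hβ

/-- **(β), `F₁` tight, partnerless `r`-members inside `R₁`, a partner member above `R₁`.** -/
theorem diffsY_subset_diffsX_of_tight_partr_sub (h1 : Tight (partr r F))
    (hk : ∃ k ∈ partner r F, Rstar (partr r F) ⊆ k)
    (hsub : ∀ t ∈ partr r F, t ∉ part0 r F → t ⊆ Rstar (partr r F)) :
    diffsY r F ⊆ diffsX r F := by
  intro z hz
  obtain ⟨t, ht, s, hs, rfl⟩ := mem_diffs.1 hz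
  by_cases ht0 : t ∈ part0 r F
  · exact mem_union.2 (Or.inl (mem_union.2 (Or.inl (mem_diffs.2 ⟨t, ht0, s, hs, rfl⟩))))
  obtain ⟨k, hk, hRk⟩ := hk
  have htR := hsub t ht ht0
  set R := Rstar (partr r F) with hRdef
  -- `k ∖ s ∈ X ∩ Y = K ∖∖ K ⊆ F₁ ∖∖ F₁ = flip R F₁`
  have h1' : k \ s ∈ diffsX r F ∩ diffsY r F := by
    refine mem_inter.2 ⟨?_, mem_diffs.2 ⟨k, (mem_inter.1 hk).2, s, hs, rfl⟩⟩
    exact mem_union.2 (Or.inl (mem_union.2 (Or.inl (mem_diffs.2 ⟨k, (mem_inter.1 hk).1, s, hs, rfl⟩))))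
  rw [hβ] at h1'
  have h2 : k \ s ∈ partr r F \\ partr r F :=
    diffs_subset (inter_subset_right) (inter_subset_right) h1'
  rw [diffs_eq_flip_of_tight h1] at h2
  obtain ⟨b, hb, hbR⟩ := mem_flip.1 h2
  refine sdiff_mem_diffsX_of_disjoint_mem_partr hP htf hz hb ?_
  rw [Finset.disjoint_left]
  intro x hx hxb
  have hxt : x ∈ t := (mem_sdiff.1 hx).1
  have hxs : x ∉ s := (mem_sdiff.1 hx).2
  have hxR : x ∈ R := htR hxt
  have hxk : x ∈ k := hRk hxR
  have := Finset.ext_iff.1 hbR x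
  simp only [mem_symmDiff, mem_sdiff] at this
  tauto

/-- **(β), `F₀` tight, partnerless `r`-free members above `R₀`, a partner member below `R₀`.** -/
theorem diffsY_subset_diffsX_of_tight_part0_sup (h0 : Tight (part0 r F))
    (hk : ∃ k ∈ partner r F, k ⊆ Rstar (part0 r F))
    (hsup : ∀ s ∈ part0 r F, s ∉ partr r F → Rstar (part0 r F) ⊆ s) :
    diffsY r F ⊆ diffsX r F := by
  intro z hz
  obtain ⟨t, ht, s, hs, rfl⟩ := mem_diffs.1 hz
  by_cases hs1 : s ∈ partr r F
  · exact mem_union.2 (Or.inl (mem_union.2 (Or.inr (mem_diffs.2 ⟨t, ht, s, hs1, rfl⟩))))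
  obtain ⟨k, hk, hkR⟩ := hk
  have hRs := hsup s hs hs1
  set R := Rstar (part0 r F) with hRdef
  -- `t ∖ k ∈ X ∩ Y = K ∖∖ K ⊆ F₀ ∖∖ F₀ = flip R F₀`
  have h1' : t \ k ∈ diffsX r F ∩ diffsY r F := by
    refine mem_inter.2 ⟨?_, mem_diffs.2 ⟨t, ht, k, (mem_inter.1 hk).1, rfl⟩⟩
    exact mem_union.2 (Or.inl (mem_union.2 (Or.inr (mem_diffs.2 ⟨t, ht, k, (mem_inter.1 hk).2, rfl⟩))))
  rw [hβ] at h1'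
  have h2 : t \ k ∈ part0 r F \\ part0 r F :=
    diffs_subset (inter_subset_left) (inter_subset_left) h1'
  rw [diffs_eq_flip_of_tight h0] at h2
  obtain ⟨a, ha, haR⟩ := mem_flip.1 h2
  refine sdiff_mem_diffsX_of_superset_mem_part0 hP htf hz ha ?_
  intro x hx
  have hxt : x ∈ t := (mem_sdiff.1 hx).1
  have hxs : x ∉ s := (mem_sdiff.1 hx).2
  have hxR : x ∉ R := fun h => hxs (hRs h)
  have hxk : x ∉ k := fun h => hxR (hkR h)
  have := Finset.ext_iff.1 haR x
  simp only [mem_symmDiff, mem_sdiff] at this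
  tauto

end PercRepro.MSTight
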